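import Literature.MathematicalPhysics.QuantumLattice.HeisenbergOrderNeelShortRange
import Literature.MathematicalPhysics.QuantumLattice.SpinChainsSpinSystemProofs
import HarnessLib

/-!
# Kennedy–Lieb–Shastry 1988, eqs. (2)–(4) and (6)–(9): the two-sum-rule bound on Néel order, in finite volume

Kennedy, Lieb and Shastry (*J. Stat. Phys.* **53** (1988) 1019–1030, §2) bound the Néel order
parameter of the quantum Heisenberg antiferromagnet from below using three ingredients, all of
which are theorems of this tree on the even torus `Λ = (ℤ/2kℤ)^d`:

* **(1)** the `T = 0` infrared bound `0 ≤ ĝ_q ≤ f_q := (-ε/2)^{1/2} (E_q/E_{q-Q})^{1/2}` for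
  `q ≠ Q` (`heis_infraredBound`; `ε = heisBondCorr` the nearest-neighbour correlation per
  component, `E_q = Σᵢ (1 - cos qᵢ)`);
* **(2)** the total sum rule `|Λ|⁻¹ Σ_q ĝ_q = S(S+1)/3` (proved here: `heis_structureFactor_totalSumRule`,
  from the on-site Casimir and isotropy);
* **(3)** the energy sum rule `|Λ|⁻¹ Σ_q ĝ_q (d⁻¹ Σᵢ cos qᵢ) = ε` (`heis_structureFactor_sumRule`).

KLS first use (1) in (3) alone, which gives their inequality (4) (`kls_heis_ineq4` of
`HeisenbergOrderNeelAssembly.lean`), and then remark (p. 1022, eqs. (6)–(9)) that (2) "has not been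
used" and that the best bound obtainable from (1)–(3) is a linear programme: maximise `∫ g` subject
to `0 ≤ g ≤ f` and the energy constraint, whose maximiser is `f` cut off on a half space of
`C_q = Σᵢ cos qᵢ` (their (9a)/(9b)). This file proves the finite-volume form of that linear
programme in its dual (Lagrangian) form, with the `δ`-function weight `m² = |Λ|⁻¹ ĝ_Q` RETAINED
rather than assumed zero: for every real multiplier `t`,

  `|Λ|⁻¹ ĝ_Q ≥ (1 - t) S(S+1)/3 + t (-ε) - (-ε/2)^{1/2} 𝓦_t(L)`,
  `𝓦_t(L) := L^{-d} Σ_{q ≠ Q} {(1 - t) - t C_q/d}₊ (E_q/E_{q-Q})^{1/2}`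

(`kls_heis_twoSumRule`; `t = 1` is (4): `klsTwoSumRiemannSum_one`; `t = 0` uses (2) alone).
Eliminating the energy by the arithmetic–geometric mean gives the energy-free corollary
`|Λ|⁻¹ ĝ_Q ≥ (1 - t) S(S+1)/3 - 𝓦_t(L)²/(8t)` (`kls_heis_twoSumRule_energyFree`, `t > 0`), and
monotonicity in `-ε` gives the forms consuming a certified UPPER (resp. LOWER) bound on the
ground-state energy (`kls_heis_twoSumRule_of_groundEnergy_le` / `_of_le_groundEnergy`), which is how
a variational energy enters (KLS p. 1022: "`e₀` can range between the Néel energy and Anderson's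
lower bound").

Nothing numerical is asserted here: the Riemann sums `𝓦_t(L)` are left unevaluated (certified
evaluations for specific `L` belong with their certificates, not in `Literature/`).

References: T. Kennedy, E.H. Lieb, B.S. Shastry, J. Stat. Phys. 53 (1988) 1019 [KLS1988JSP],
eqs. (1)–(4), (6)–(9); F.J. Dyson, E.H. Lieb, B. Simon, J. Stat. Phys. 18 (1978) 335 (the sum-rule
strategy with (2)); E.J. Neves, J.F. Perez, Phys. Lett. 114A (1986) 331.
-/

noncomputable section

open Filter Topology Matrix Finset
open Literature.MathematicalPhysics.QuantumLattice Literature.Probability.LatticeModels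

namespace Literature.MathematicalPhysics.QuantumLattice

variable {d : ℕ}

/-! ### The total sum rule (2) -/

/-- The on-site value of the two-point function: `G⁰_L(x,x) = ⟨(S³_x)²⟩ = S(S+1)/3` (`S = n/2`), from
the on-site Casimir `Σ_α (Sᵅ_x)² = S(S+1)𝟙` and isotropy of the tracial ground state.
[Kennedy–Lieb–Shastry 1988, eq. (2) and p. 1021] [cite: KLS1988JSP, eq. (2)] -/
theorem heisGroundCorr_self (L : ℕ) [NeZero L] (n : ℕ) (x : TorusSite d L) :
    heisGroundCorr 0 L n x x = (n : ℝ) / 2 * ((n : ℝ) / 2 + 1) / 3 := by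
  have hH := heisenbergTorus_isHermitian d L n 1
  haveI : Nonempty (TensorIndex (TorusSite d L) (n + 1)) := ⟨fun _ => 0⟩
  have h3 : ∑ α : Fin 3, heisGroundCorr α L n x x = (n : ℝ) / 2 * ((n : ℝ) / 2 + 1) := by
    simp_rw [heisGroundCorr_of_neZero]
    rw [← Complex.re_sum, ← map_sum, sum_siteSpin_mul_siteSpin_holds n x, LinearMap.map_smul,
      groundStateFunctional_one hH, smul_eq_mul, mul_one]
    have : ((n : ℂ) / 2 * ((n : ℂ) / 2 + 1)) = (((n : ℝ) / 2 * ((n : ℝ) / 2 + 1) : ℝ) : ℂ) := by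
      push_cast; ring
    rw [this, Complex.ofReal_re]
  rw [Fin.sum_univ_three, heisGroundCorr_one_eq_zero, heisGroundCorr_two_eq_zero] at h3
  linarith

/-- **The total sum rule (2) in finite volume**: `Σ_q ĝ_q = |Λ| S(S+1)/3` on the torus of side `L ≥ 1`
(character orthogonality at displacement `0` and `G⁰_L(x,x) = S(S+1)/3`).
[Kennedy–Lieb–Shastry 1988, eq. (2)] [cite: KLS1988JSP, eq. (2)] -/
theorem heis_structureFactor_totalSumRule (L : ℕ) [NeZero L] (n : ℕ) :
    ∑ q : TorusSite d L, heisStructureFactor 0 L n q =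
      (L : ℝ) ^ d * ((n : ℝ) / 2 * ((n : ℝ) / 2 + 1) / 3) := by
  have hL1 : (L : ℝ) ≠ 0 := by exact_mod_cast NeZero.ne L
  have hL0 : (L : ℝ) ^ d ≠ 0 := pow_ne_zero _ hL1
  have hcard : (Fintype.card (TorusSite d L) : ℝ) = (L : ℝ) ^ d := by
    rw [Fintype.card_pi, prod_const, ZMod.card, card_univ, Fintype.card_fin]; push_cast; ring
  have h0 : ∀ q : TorusSite d L, Real.cos (torusPhase L q 0) = 1 := by
    intro q; simp [torusPhase]
  have h := sum_structureFactor_mul_cos_torusPhase L (heisGroundCorr (d := d) 0 L n)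
    (heisGroundCorr_symm (d := d) 0 L n) (0 : TorusSite d L)
  simp_rw [h0, mul_one, add_zero, heisGroundCorr_self L n, sum_const, card_univ, nsmul_eq_mul,
    hcard] at h
  simp_rw [heisStructureFactor_of_neZero]
  rw [← sum_div, h]
  field_simp

/-! ### The two-sum-rule kernel and its punctured Riemann sum -/

/-- **The two-sum-rule multiplier** `K_t(q) = (1 - t) - t · d⁻¹ Σᵢ cos qᵢ` at the dual-torus point `q`:
the combination "`(1 - t)` × (2) `- t` × (3)" of the two sum rules has `Σ_q K_t(q) ĝ_q` on the left
(`K_t(Q) = 1`). For `0 < t ≤ 1` its positive part is supported on the half space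
`C_q < d(1 - t)/t`, KLS's maximiser (9a). [Kennedy–Lieb–Shastry 1988, eqs. (6)–(9)]
[cite: KLS1988JSP, eqs. (6)-(9)] -/
def klsTwoSumKernel (t : ℝ) (L : ℕ) (q : TorusSite d L) : ℝ :=
  (1 - t) - t * (torusCosSum L q / d)

/-- **The punctured Riemann sum of the two-sum-rule bound**,
`𝓦_t(L) = L^{-d} Σ_{q ≠ Q} {K_t(q)}₊ (E_q/E_{q-Q})^{1/2}` (`E_q = Σᵢ (1 - cos qᵢ)`, `Q = (π,…,π)`;
junk value `0` at `L = 0`). At `t = 1` it is the Riemann sum of KLS's (4)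
(`klsTwoSumRiemannSum_one`). [Kennedy–Lieb–Shastry 1988, eqs. (4), (6)–(9)]
[cite: KLS1988JSP, eqs. (6)-(9)] -/
def klsTwoSumRiemannSum (t : ℝ) (L : ℕ) : ℝ :=
  if hL : L = 0 then 0
  else
    haveI : NeZero L := ⟨hL⟩
    (∑ q ∈ (univ : Finset (TorusSite d L)).erase (neelIndex L),
        max (klsTwoSumKernel t L q) 0 *
          Real.sqrt (dispersion (latticeMomentum L q) /
            dispersion (latticeMomentum L (q - neelIndex L)))) / (L : ℝ) ^ d

/-- Unfolding `𝓦_t(L)` on a genuine torus (`L ≥ 1`): the finite-volume Riemann sum of the integrand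
of KLS's bound with the cut-off maximiser (9a)/(9b). [Kennedy–Lieb–Shastry 1988, eqs. (6)–(9)]
[cite: KLS1988JSP, eqs. (6)-(9)] -/
theorem klsTwoSumRiemannSum_of_neZero (t : ℝ) (L : ℕ) [NeZero L] :
    klsTwoSumRiemannSum (d := d) t L =
      (∑ q ∈ (univ : Finset (TorusSite d L)).erase (neelIndex L),
          max (klsTwoSumKernel t L q) 0 *
            Real.sqrt (dispersion (latticeMomentum L q) /
              dispersion (latticeMomentum L (q - neelIndex L)))) / (L : ℝ) ^ d := by
  simp [klsTwoSumRiemannSum, NeZero.ne L]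

/-- `𝓦_t(L) ≥ 0` (the integrand `{K_t}₊ (E_q/E_{q-Q})^{1/2}` of KLS's bound is non-negative).
[Kennedy–Lieb–Shastry 1988, eqs. (6)–(9)] [cite: KLS1988JSP, eqs. (6)-(9)] -/
theorem klsTwoSumRiemannSum_nonneg (t : ℝ) (L : ℕ) : 0 ≤ klsTwoSumRiemannSum (d := d) t L := by
  rcases Nat.eq_zero_or_pos L with rfl | hL
  · simp [klsTwoSumRiemannSum]
  haveI : NeZero L := ⟨hL.ne'⟩
  rw [klsTwoSumRiemannSum_of_neZero]
  refine div_nonneg (sum_nonneg fun q _ => mul_nonneg (le_max_right _ _) (Real.sqrt_nonneg _)) ?_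
  positivity

/-- `K_t(Q) = 1` (`Σᵢ cos Qᵢ = -d`): in the combination of the sum rules (2), (3) the Néel
`δ`-function weight at `Q` enters with coefficient one. [Kennedy–Lieb–Shastry 1988, p. 1021 and
eqs. (6)–(9)] [cite: KLS1988JSP, eqs. (6)-(9)] -/
theorem klsTwoSumKernel_neelIndex (hd : 1 ≤ d) (t : ℝ) (k : ℕ) [NeZero (2 * k)] :
    klsTwoSumKernel t (2 * k) (neelIndex (2 * k) : TorusSite d (2 * k)) = 1 := by
  have hd0 : (d : ℝ) ≠ 0 := by exact_mod_cast (show d ≠ 0 by omega)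
  rw [klsTwoSumKernel, torusCosSum_neelIndex k, neg_div, div_self hd0]
  ring

/-- **`t = 1` is KLS's (4)**: `𝓦_1(L) = 𝓡_L` (`klsRiemannSum`), by the shift `q = p + Q`
(`E_{p+Q} = Σᵢ(1 + cos pᵢ)`, `{-C_{p+Q}/d}₊ = {C_p/d}₊`). [Kennedy–Lieb–Shastry 1988, eq. (4)]
[cite: KLS1988JSP, eq. (4)] -/
theorem klsTwoSumRiemannSum_one (k : ℕ) [NeZero (2 * k)] :
    klsTwoSumRiemannSum (d := d) 1 (2 * k) = klsRiemannSum d (2 * k) := by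
  rw [klsTwoSumRiemannSum_of_neZero, klsRiemannSum_of_neZero]
  rw [show (∑ p ∈ (univ : Finset (TorusSite d (2 * k))).erase 0,
        klsIntegrand d (latticeMomentum (2 * k) p)) =
      ∑ q ∈ (univ : Finset (TorusSite d (2 * k))).erase (neelIndex (2 * k)),
        klsIntegrand d (latticeMomentum (2 * k) (q - neelIndex (2 * k))) from
    (sum_erase_neelIndex_shift k (fun p => klsIntegrand d (latticeMomentum (2 * k) p))).symm]
  congr 1
  refine sum_congr rfl fun q _ => ?_
  rw [klsIntegrand_latticeMomentum_sub_neelIndex k q, dispersion_latticeMomentum_sub_neelIndex k q,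
    klsTwoSumKernel]
  have : (1 - 1 : ℝ) - 1 * (torusCosSum (2 * k) q / d) = -torusCosSum (2 * k) q / d := by ring
  rw [this, mul_comm]

/-! ### The two-sum-rule bound (6)–(9) in finite volume -/

/-- **Kennedy–Lieb–Shastry's two-sum-rule bound, finite volume, dual form.** On the even torus of
side `L = 2k ≥ 4`, `d ≥ 1`, every spin `S = n/2` and EVERY real multiplier `t`:
`(1 - t) S(S+1)/3 + t(-ε) - (-ε/2)^{1/2} 𝓦_t(L) ≤ |Λ|⁻¹ ĝ_Q`.
Proof: `(1 - t)` × (2) `- t` × (3) reads `|Λ|[(1-t)S(S+1)/3 - tε] = ĝ_Q + Σ_{q ≠ Q} K_t(q) ĝ_q`, and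
every `q ≠ Q` term is at most `{K_t(q)}₊ f_q` by the infrared bound (1) (`0 ≤ ĝ_q ≤ f_q`). With
`m² := |Λ|⁻¹ ĝ_Q` set to zero and `L → ∞` this is the statement that KLS's linear programme
(6)–(8) is infeasible, i.e. their contradiction "max I < S(S+1)/3"; the family `t` parametrises the
cut-off half spaces (9a)/(9b). [Kennedy–Lieb–Shastry 1988, eqs. (2), (3), (6)–(9)]
[cite: KLS1988JSP, eqs. (6)-(9)] -/
theorem kls_heis_twoSumRule (hd : 1 ≤ d) (n k : ℕ) (hk : 2 ≤ k) (t : ℝ) :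
    (1 - t) * ((n : ℝ) / 2 * ((n : ℝ) / 2 + 1) / 3) + t * (-heisBondCorr (d := d) 0 (2 * k) n) -
        Real.sqrt (-heisBondCorr (d := d) 0 (2 * k) n / 2) *
          klsTwoSumRiemannSum (d := d) t (2 * k) ≤
      heisStructureFactor 0 (2 * k) n (neelIndex (2 * k) : TorusSite d (2 * k)) /
        ((2 * k : ℕ) : ℝ) ^ d := by
  haveI : NeZero (2 * k) := ⟨by omega⟩
  have hd0 : 0 < d := by omega
  have h2k : (0 : ℝ) < ((2 * k : ℕ) : ℝ) := by exact_mod_cast (show 0 < 2 * k by omega)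
  have hL : (0 : ℝ) < ((2 * k : ℕ) : ℝ) ^ d := pow_pos h2k d
  set Q : TorusSite d (2 * k) := neelIndex (2 * k) with hQ
  set ε := heisBondCorr (d := d) 0 (2 * k) n with hε
  set s := -ε / 2 with hs_def
  set c := (n : ℝ) / 2 * ((n : ℝ) / 2 + 1) / 3 with hc
  set g : TorusSite d (2 * k) → ℝ := fun q => heisStructureFactor 0 (2 * k) n q with hg
  -- `s ≥ 0` from the Néel bound
  have hN := heisBondCorr_le hd n k hk
  have hs : 0 ≤ s := by
    rw [hs_def]
    have : 0 ≤ ((n : ℝ) / 2) ^ 2 / 3 := by positivity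
    linarith
  -- (3): `ε |Λ| = -ĝ_Q + Σ_{q ≠ Q} ĝ_q C_q/d`
  have hE : ε * ((2 * k : ℕ) : ℝ) ^ d =
      -g Q + ∑ q ∈ (univ : Finset (TorusSite d (2 * k))).erase Q,
        g q * (torusCosSum (2 * k) q / d) := by
    have h := heis_sumRule_split hd 0 k n
    rw [← hε, ← hQ] at h
    simpa only [hg] using h
  -- (2): `|Λ| S(S+1)/3 = ĝ_Q + Σ_{q ≠ Q} ĝ_q`
  have hT : ((2 * k : ℕ) : ℝ) ^ d * c =
      g Q + ∑ q ∈ (univ : Finset (TorusSite d (2 * k))).erase Q, g q := by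
    rw [hc, ← heis_structureFactor_totalSumRule (2 * k) n, ← add_sum_erase _ _ (mem_univ Q)]
  -- the combination `(1 - t)·(2) - t·(3)`
  have hK : ∑ q ∈ (univ : Finset (TorusSite d (2 * k))).erase Q, g q * klsTwoSumKernel t (2 * k) q =
      (1 - t) * ∑ q ∈ (univ : Finset (TorusSite d (2 * k))).erase Q, g q -
        t * ∑ q ∈ (univ : Finset (TorusSite d (2 * k))).erase Q,
          g q * (torusCosSum (2 * k) q / d) := by
    rw [mul_sum, mul_sum, ← sum_sub_distrib]
    refine sum_congr rfl fun q _ => ?_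
    rw [klsTwoSumKernel]
    ring
  have hcomb : g Q = ((2 * k : ℕ) : ℝ) ^ d * (t * (-ε) + (1 - t) * c) -
      ∑ q ∈ (univ : Finset (TorusSite d (2 * k))).erase Q, g q * klsTwoSumKernel t (2 * k) q := by
    rw [hK]
    linear_combination t * hE + (t - 1) * hT
  -- termwise infrared bound on the punctured sum
  have hterm : ∀ q ∈ (univ : Finset (TorusSite d (2 * k))).erase Q,
      g q * klsTwoSumKernel t (2 * k) q ≤
        Real.sqrt s * (max (klsTwoSumKernel t (2 * k) q) 0 *
          Real.sqrt (dispersion (latticeMomentum (2 * k) q) /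
            dispersion (latticeMomentum (2 * k) (q - Q)))) := by
    intro q hq
    have hqQ : q ≠ Q := (mem_erase.1 hq).1
    obtain ⟨hgq, hAq⟩ := heis_infraredBound hd0 n k hk q hqQ
    have hE' : 0 < dispersion (latticeMomentum (2 * k) (q - Q)) :=
      dispersion_latticeMomentum_pos (sub_ne_zero.2 hqQ)
    rw [← hε] at hAq
    rw [hg, mul_comm]
    exact kls_heis_pointwise11 hgq hE' hs hAq
  have hsum := sum_le_sum hterm
  rw [← mul_sum] at hsum
  rw [klsTwoSumRiemannSum_of_neZero, ← hQ, le_div_iff₀ hL]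
  have hrw : ((1 - t) * c + t * (-ε) -
      Real.sqrt s * ((∑ q ∈ (univ : Finset (TorusSite d (2 * k))).erase Q,
        max (klsTwoSumKernel t (2 * k) q) 0 *
          Real.sqrt (dispersion (latticeMomentum (2 * k) q) /
            dispersion (latticeMomentum (2 * k) (q - Q)))) / ((2 * k : ℕ) : ℝ) ^ d)) *
        ((2 * k : ℕ) : ℝ) ^ d =
      ((2 * k : ℕ) : ℝ) ^ d * (t * (-ε) + (1 - t) * c) -
        Real.sqrt s * ∑ q ∈ (univ : Finset (TorusSite d (2 * k))).erase Q,
          max (klsTwoSumKernel t (2 * k) q) 0 *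
            Real.sqrt (dispersion (latticeMomentum (2 * k) q) /
              dispersion (latticeMomentum (2 * k) (q - Q))) := by
    field_simp
    ring
  rw [hrw]
  have hgQ : g Q = heisStructureFactor 0 (2 * k) n Q := rfl
  rw [← hgQ, hcomb]
  linarith [hsum]

/-- **The energy-free form.** For `t > 0`, minimising the two-sum-rule bound over the unknown
`-ε ≥ 0` (arithmetic–geometric mean: `t u - (u/2)^{1/2} 𝓦 ≥ -𝓦²/(8t)`):
`(1 - t) S(S+1)/3 - 𝓦_t(L)²/(8t) ≤ |Λ|⁻¹ ĝ_Q` — a lower bound on the Néel order parameter of the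
finite torus that uses no information about the ground-state energy at all.
[Kennedy–Lieb–Shastry 1988, eqs. (6)–(9) (with `e₀` eliminated)] [cite: KLS1988JSP, eqs. (6)-(9)] -/
theorem kls_heis_twoSumRule_energyFree (hd : 1 ≤ d) (n k : ℕ) (hk : 2 ≤ k) {t : ℝ} (ht : 0 < t) :
    (1 - t) * ((n : ℝ) / 2 * ((n : ℝ) / 2 + 1) / 3) -
        klsTwoSumRiemannSum (d := d) t (2 * k) ^ 2 / (8 * t) ≤
      heisStructureFactor 0 (2 * k) n (neelIndex (2 * k) : TorusSite d (2 * k)) /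
        ((2 * k : ℕ) : ℝ) ^ d := by
  haveI : NeZero (2 * k) := ⟨by omega⟩
  have hmain := kls_heis_twoSumRule hd n k hk t
  set u := -heisBondCorr (d := d) 0 (2 * k) n with hu
  set W := klsTwoSumRiemannSum (d := d) t (2 * k) with hW
  have hN := heisBondCorr_le hd n k hk
  have hu0 : 0 ≤ u / 2 := by
    rw [hu]
    have : 0 ≤ ((n : ℝ) / 2) ^ 2 / 3 := by positivity
    linarith
  set a := Real.sqrt (u / 2) with ha
  have ha2 : a ^ 2 = u / 2 := Real.sq_sqrt hu0
  have key : 2 * t * a ^ 2 - a * W + W ^ 2 / (8 * t) = (4 * t * a - W) ^ 2 / (8 * t) := by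
    field_simp
    ring
  have hpos : 0 ≤ (4 * t * a - W) ^ 2 / (8 * t) := by positivity
  have : t * u = 2 * t * a ^ 2 := by rw [ha2]; ring
  nlinarith [hmain, key, hpos, this]

/-- Monotonicity of the two-sum-rule bound in the energy variable: for `0 ≤ t`, `b ≤ a` and
`𝓦 ≤ 4 t b`, `t(2b²) - b 𝓦 ≤ t(2a²) - a 𝓦` (the bound `A + t u - (u/2)^{1/2} 𝓦` is increasing in
`u` on `u ≥ 𝓦²/(8t²)`). [folklore] -/
private theorem kls_twoSumRule_mono_aux {t a b W : ℝ} (ht : 0 ≤ t) (hab : b ≤ a)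
    (hW : W ≤ 4 * t * b) :
    t * (2 * b ^ 2) - b * W ≤ t * (2 * a ^ 2) - a * W := by
  have h1 : t * (2 * a ^ 2) - a * W - (t * (2 * b ^ 2) - b * W) = (a - b) * (2 * t * (a + b) - W) := by
    ring
  have h2 : 0 ≤ (a - b) * (2 * t * (a + b) - W) :=
    mul_nonneg (by linarith) (by nlinarith)
  linarith

/-- **The two-sum-rule bound with a certified UPPER bound on the energy.** If the ground-state
energy of the spin-`n/2` antiferromagnet `Σ_{⟨xy⟩} 𝐒_x·𝐒_y` on the even torus of side `2k ≥ 4`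
satisfies `E₀ ≤ E⁺` (e.g. a variational / certified MPS energy), put `u⁺ := -E⁺/(3d|Λ|) ≤ -ε`; then for
every `0 ≤ t` in the increasing regime `𝓦_t(L)² ≤ 8 t² u⁺`:
`(1 - t) S(S+1)/3 + t u⁺ - (u⁺/2)^{1/2} 𝓦_t(L) ≤ |Λ|⁻¹ ĝ_Q`. This is how "`e₀` can range between the
Néel-state energy and Anderson's lower bound" (KLS p. 1022) is used on a finite lattice: only the
upper end of the energy bracket is consumed. [Kennedy–Lieb–Shastry 1988, eqs. (6)–(9) and p. 1022]
[cite: KLS1988JSP, eqs. (6)-(9)] -/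
theorem kls_heis_twoSumRule_of_groundEnergy_le (hd : 1 ≤ d) (n k : ℕ) (hk : 2 ≤ k)
    [NeZero (2 * k)] {t Eup : ℝ} (ht : 0 ≤ t)
    (hE : (heisenbergTorus d (2 * k) n 1).groundEnergy ≤ Eup)
    (hup : 0 ≤ -Eup / (3 * (d : ℝ) * ((2 * k : ℕ) : ℝ) ^ d))
    (hmono : klsTwoSumRiemannSum (d := d) t (2 * k) ^ 2 ≤
      8 * t ^ 2 * (-Eup / (3 * (d : ℝ) * ((2 * k : ℕ) : ℝ) ^ d))) :
    (1 - t) * ((n : ℝ) / 2 * ((n : ℝ) / 2 + 1) / 3) +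
          t * (-Eup / (3 * (d : ℝ) * ((2 * k : ℕ) : ℝ) ^ d)) -
        Real.sqrt (-Eup / (3 * (d : ℝ) * ((2 * k : ℕ) : ℝ) ^ d) / 2) *
          klsTwoSumRiemannSum (d := d) t (2 * k) ≤
      heisStructureFactor 0 (2 * k) n (neelIndex (2 * k) : TorusSite d (2 * k)) /
        ((2 * k : ℕ) : ℝ) ^ d := by
  have hmain := kls_heis_twoSumRule hd n k hk t
  have hd0 : (0 : ℝ) < d := by exact_mod_cast (show 0 < d by omega)
  have hLd : (0 : ℝ) < ((2 * k : ℕ) : ℝ) ^ d := by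
    have : (0 : ℝ) < ((2 * k : ℕ) : ℝ) := by exact_mod_cast (show 0 < 2 * k by omega)
    positivity
  set ua := -Eup / (3 * (d : ℝ) * ((2 * k : ℕ) : ℝ) ^ d) with hua
  set u := -heisBondCorr (d := d) 0 (2 * k) n with hu
  set W := klsTwoSumRiemannSum (d := d) t (2 * k) with hW
  -- `ua ≤ u` from `E₀ ≤ E⁺` and `ε = E₀/(3d|Λ|)`
  have hle : ua ≤ u := by
    rw [hua, hu, heisBondCorr_eq_groundEnergy_div hd n k hk, ← neg_div]
    exact div_le_div_of_nonneg_right (by linarith) (by positivity)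
  set a := Real.sqrt (u / 2) with ha
  set b := Real.sqrt (ua / 2)
  have hb0 : 0 ≤ b := Real.sqrt_nonneg _
  have hab : b ≤ a := Real.sqrt_le_sqrt (by linarith)
  have ha2 : a ^ 2 = u / 2 := Real.sq_sqrt (by linarith)
  have hb2 : b ^ 2 = ua / 2 := Real.sq_sqrt (by linarith)
  have hW0 : 0 ≤ W := klsTwoSumRiemannSum_nonneg t (2 * k)
  have hWb : W ≤ 4 * t * b := by
    have h1 : W ^ 2 ≤ (4 * t * b) ^ 2 := by nlinarith [hmono, hb2]
    have h2 : 0 ≤ 4 * t * b := by positivity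
    nlinarith [h1, h2, hW0]
  have hm := kls_twoSumRule_mono_aux ht hab hWb
  have e1 : t * u = t * (2 * a ^ 2) := by rw [ha2]; ring
  have e2 : t * ua = t * (2 * b ^ 2) := by rw [hb2]; ring
  linarith [hmain, hm, e1, e2]

/-- **The two-sum-rule bound with a certified LOWER bound on the energy** (the decreasing regime):
if `E⁻ ≤ E₀`, put `u⁻ := -E⁻/(3d|Λ|) ≥ -ε`; then for every `0 ≤ t` with `8 t² u⁻ ≤ 𝓦_t(L)²`:
`(1 - t) S(S+1)/3 + t u⁻ - (u⁻/2)^{1/2} 𝓦_t(L) ≤ |Λ|⁻¹ ĝ_Q` (e.g. with Anderson's bound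
`heisenbergAF_torus_groundEnergy_ge`). [Kennedy–Lieb–Shastry 1988, eqs. (6)–(9) and p. 1022]
[cite: KLS1988JSP, eqs. (6)-(9)] -/
theorem kls_heis_twoSumRule_of_le_groundEnergy (hd : 1 ≤ d) (n k : ℕ) (hk : 2 ≤ k)
    [NeZero (2 * k)] {t Elo : ℝ} (ht : 0 ≤ t)
    (hE : Elo ≤ (heisenbergTorus d (2 * k) n 1).groundEnergy)
    (hmono : 8 * t ^ 2 * (-Elo / (3 * (d : ℝ) * ((2 * k : ℕ) : ℝ) ^ d)) ≤
      klsTwoSumRiemannSum (d := d) t (2 * k) ^ 2) :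
    (1 - t) * ((n : ℝ) / 2 * ((n : ℝ) / 2 + 1) / 3) +
          t * (-Elo / (3 * (d : ℝ) * ((2 * k : ℕ) : ℝ) ^ d)) -
        Real.sqrt (-Elo / (3 * (d : ℝ) * ((2 * k : ℕ) : ℝ) ^ d) / 2) *
          klsTwoSumRiemannSum (d := d) t (2 * k) ≤
      heisStructureFactor 0 (2 * k) n (neelIndex (2 * k) : TorusSite d (2 * k)) /
        ((2 * k : ℕ) : ℝ) ^ d := by
  have hmain := kls_heis_twoSumRule hd n k hk t
  have hd0 : (0 : ℝ) < d := by exact_mod_cast (show 0 < d by omega)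
  have hLd : (0 : ℝ) < ((2 * k : ℕ) : ℝ) ^ d := by
    have : (0 : ℝ) < ((2 * k : ℕ) : ℝ) := by exact_mod_cast (show 0 < 2 * k by omega)
    positivity
  have hN := heisBondCorr_le hd n k hk
  set ub := -Elo / (3 * (d : ℝ) * ((2 * k : ℕ) : ℝ) ^ d) with hub
  set u := -heisBondCorr (d := d) 0 (2 * k) n with hu
  set W := klsTwoSumRiemannSum (d := d) t (2 * k) with hW
  have hu0 : 0 ≤ u := by
    rw [hu]
    have : 0 ≤ ((n : ℝ) / 2) ^ 2 / 3 := by positivity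
    linarith
  -- `u ≤ ub` from `E⁻ ≤ E₀`
  have hle : u ≤ ub := by
    rw [hub, hu, heisBondCorr_eq_groundEnergy_div hd n k hk, ← neg_div]
    exact div_le_div_of_nonneg_right (by linarith) (by positivity)
  set a := Real.sqrt (ub / 2) with ha
  set b := Real.sqrt (u / 2) with hb
  have hb0 : 0 ≤ b := Real.sqrt_nonneg _
  have ha0 : 0 ≤ a := Real.sqrt_nonneg _
  have hab : b ≤ a := Real.sqrt_le_sqrt (by linarith)
  have ha2 : a ^ 2 = ub / 2 := Real.sq_sqrt (by linarith)
  have hb2 : b ^ 2 = u / 2 := Real.sq_sqrt (by linarith)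
  have hW0 : 0 ≤ W := klsTwoSumRiemannSum_nonneg t (2 * k)
  -- decreasing regime: `4 t a ≤ W`, so going from `u` up to `ub` can only decrease the bound
  have hWa : 4 * t * a ≤ W := by
    have h1 : (4 * t * a) ^ 2 ≤ W ^ 2 := by nlinarith [hmono, ha2]
    have h2 : 0 ≤ 4 * t * a := by positivity
    nlinarith [h1, h2, hW0]
  have h1 : t * (2 * a ^ 2) - a * W - (t * (2 * b ^ 2) - b * W) =
      (a - b) * (2 * t * (a + b) - W) := by ring
  have h2 : (a - b) * (2 * t * (a + b) - W) ≤ 0 :=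
    mul_nonpos_of_nonneg_of_nonpos (by linarith) (by nlinarith)
  have e1 : t * ub = t * (2 * a ^ 2) := by rw [ha2]; ring
  have e2 : t * u = t * (2 * b ^ 2) := by rw [hb2]; ring
  linarith [hmain, h1, h2, e1, e2]

/-- **The Néel order parameter form** (spin `n/2`, coupling `J > 0`, `t > 0`): the staggered,
volume-normalised double sum `m_s²(L) = |Λ|⁻² Σ_{x,y} (-1)^x (-1)^y ⟨𝐒_x·𝐒_y⟩` of
`HeisenbergOrder.lean` equals `3|Λ|⁻¹ ĝ_Q` (`neelSum_eq`), so the energy-free two-sum-rule bound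
reads `3[(1 - t) S(S+1)/3 - 𝓦_t(L)²/(8t)] ≤ m_s²(L)` on every even torus of side `≥ 4`.
[Kennedy–Lieb–Shastry 1988, eqs. (6)–(9) and p. 1021] [cite: KLS1988JSP, eqs. (6)-(9)] -/
theorem kls_heis_neelSum_ge_energyFree (hd : 1 ≤ d) (n k : ℕ) (hk : 2 ≤ k) [NeZero (2 * k)]
    {J : ℝ} (hJ : 0 < J) {t : ℝ} (ht : 0 < t) :
    3 * ((1 - t) * ((n : ℝ) / 2 * ((n : ℝ) / 2 + 1) / 3) -
        klsTwoSumRiemannSum (d := d) t (2 * k) ^ 2 / (8 * t)) ≤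
      (∑ x : TorusSite d (2 * k), ∑ y : TorusSite d (2 * k),
          (-1 : ℝ) ^ (∑ i, (x i).val) * (-1) ^ (∑ i, (y i).val) *
            groundStateSpinCorrTorus (2 * k) n J x y) / ((2 * k : ℕ) : ℝ) ^ (2 * d) := by
  rw [neelSum_eq n k hJ]
  have := kls_heis_twoSumRule_energyFree hd n k hk ht
  linarith

end Literature.MathematicalPhysics.QuantumLattice
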